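/-
Copyright (c) 2026 the pub-hodgecm-mathlib formalisation cell (harness21).  Prover seat hodgecm-mathlib-K2E1-p14 (g5), Track B ∕ K2-LIT, h413 = `stmt-HodgeConjecture-24833`,
R90-TF section S8 «ContSpec-n½», socket B MID :358, deal (V-τ) (S8-R260 (c) ∕ S8-R269 (1) ∕ S8-R272 (2), dealer R90-CS-plan (g4); LH4-p10 (g9)'s 3-line reading; census
`K2/K2E1-p14/g5/CENSUS-Vtau-NeBotOfTauGenerator.K2E1-p14-g5.md`): the τ-GENERATOR twin of ★ p864046 `resGMidBlock_ne_bot_of_ledger_letters` — ★ p863385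
`resGMidBlock_ne_bot_assembly` called BY NAME for a τ-ADMISSIBLE witness section at the finite-only level `(ι_f U₀, 1)`, its continuation the EXPORTED one of ★ p865131's τ-row
(NF-free, REPAIRED at the removable candidates à la ★ R90-C133-p02), row (i) ★ modulo the pole ledger, rows (ii) (iii) and the Maass–Selberg letter visible with named payers.
-/
import Summits.HodgeConjecture.HodgeConjecture.Theorems.R90S8ResGMidBlockNeBotAssemblyU3            -- ★ p863385 (K2E2-p12): the (V) ASSEMBLY of letters `resGMidBlock_ne_bot_assembly`
import Summits.HodgeConjecture.HodgeConjecture.Theorems.R90S8ResGMidTauExportsRowOfPortsU3           -- ★ p865131 (K2E3-p29): `hTEXP6_row_of_ports` (the K-finite exports τ-row with (E6), of ports)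
import Summits.HodgeConjecture.HodgeConjecture.Theorems.R90S8KTypeCoweightLineProductU3              -- ★ p864934 (K2E1-p12): `hCO_of_transposeRealisations` (the co-weight line letter, paid)
import Summits.HodgeConjecture.HodgeConjecture.Theorems.R90S8ResGMidAtomTransOfRecordRepairedU3      -- ★ (R90-C133-p02): §1 the REPAIRED continuation `differentiableOn_slit_of_repaired`, `exists_poleLetter_of_repaired`, `repaired_eq_of_two_lt_re`, `analyticAt_update_limUnder_of_eventually_bounded`
import Summits.HodgeConjecture.HodgeConjecture.Theorems.K2E1ChiEisensteinPoleLedgerCMThree            -- ★ p863972 (K2E2-p12): §2 generic `continuous_at_removable_of_joint_bound`, `locally_bounded_at_removable_of_joint_bound`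
import HarnessLib

/-!
# S8 socket B MID — `R90S8ResGMidBlockNeBotOfTauGeneratorLettersU3` ((V-τ), ED. 1): `LHalfNeZero (ξ.bcη⁻¹·μω) → resGMidBlock L μ ξ μω ≠ ⊥` FROM A τ-ADMISSIBLE WITNESS —
# ★ p863385 BY NAME, the continuation = ★ p865131's EXPORT (repaired), row (i) ★ modulo the pole ledger, rows (ii) (iii) + the Maass–Selberg letter VISIBLE

Track B ∕ K2-LIT, crux h413 = `stmt-HodgeConjecture-24833`, route of record `HCCMUnconditional`; cell `hodgecm-mathlib`, R90-TF programme, section S8 «ContSpec-n½», socket B MID :358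
∕ (V), the GENERAL SUB-ROW (V-τ) (S8-R260 (b)(c): ED. 9–17 of the (V) OF RECORD column serve the SCALAR sub-row `|m_w| = 1`; a witness of higher `K_∞`-type lives at a FINITE-ONLY level
`(K′ := ι_f K_f(𝔫), ω := 1)` — ★ D1 admits any level pair and ★ D3 generates over all of them, so NO hW1 is needed).  THEOREMS ONLY (no `def`, no `instance`, no `notation`, no named-fact
hypothesis, no `sorry`; default heartbeats); lane `--supports stmt-HodgeConjecture-24833 --as helper` (count-neutral).  CLOSES NO SOCKET (letters ≠ payment).

THE TWO HEADS.
* **`resGMidBlock_ne_bot_of_tauGenerator_rows`** (the workhorse; Ec AS A BINDER): after the (V) frame `(μ, μω, hμu, hμω, ξ)` — (i) a τ-level witness `φ ∈ V(ξ.bcη⁻¹·ξ.bcψ⁻¹·μω, ξ.ψ; ι_f U₀, 1)`,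
  continuous; an EXPORTED continuation `(Ec, P)` in ★ p865131's NF-free shape (closed co-discrete `P ⊆ {Re ≤ 2}`, the `E`-identity on `{2 < Re}`, analyticity ∕ (E4) ∕ (E2-bd) OFF `P`) and
  the POLE LEDGER in estate T's `hPL` bytes (`hbddPK` joint removability at the candidates of `{1 < Re} ∖ {3∕2}`, `hbdd32` simple pole at `3∕2`); (ii) (iii) ★ p863385's rows VERBATIM
  (the domain `D` additionally AVOIDS `P`); (i′) the truncated family on `D` + `hMS`.  INSIDE: the continuation is REPAIRED at the candidates (`Ec♯ z g := lim_{w → z} Ec w g` there, ★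
  `differentiableOn_slit_of_repaired`, `exists_poleLetter_of_repaired`, `repaired_eq_of_two_lt_re`), and its layer-2 rows (E4) (E2-bd) on the slit plane are PROVED here (§1: at a repaired
  point every `Ec♯ · g` is analytic — Riemann — so ★ `continuous_at_removable_of_joint_bound` (Schwarz) and ★ `locally_bounded_at_removable_of_joint_bound` apply to `Ec♯` with the
  punctured data of `Ec`; off `P` the two families agree near the point); then ★ p863385 at `(K′, ω, φ, Ec♯, Sp := {3∕2})`.
* **`resGMidBlock_ne_bot_of_tauGenerator_letters`** (the (V-τ) letter head): the witness AS DATA `(U₀ τ-level, φ, IsArchFinite)` + a normalised Heisenberg package; the exports are BOUND BY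
  NAME — ★ `hTEXP6_row_of_ports … hμu (hCO_of_transposeRealisations … hμu)` (★ p865131 ∘ ★ p864934, as (R)′τ V3 binds them) — so every row mentioning the continuation becomes a letter
  quantified over the export candidates `(Ec, P)` with their three identifying clauses (`E`-identity, co-discreteness, analyticity off `P`; the continuation is unique given `φ` ★, and the
  letters only speak of punctured neighbourhoods ∕ points off `P`, so the universal form is harmless): `hPL` (pole ledger), `hCT` (constant term off `P` on `D`), `hMS` (Maass–Selberg at
  `3∕2` for the (E6) family, `T := 1`); rows (ii)-rest and (iii) stay ★ p863385's binders.
VISIBLE → PAYER: `hPL` ⇐ τ-MS32 ★ p865152 `hMS32_midWitness_of_coordLetters (hqa32)(hreal)` + (MSP′) off-axis of (R)′τ V3 (★ `exists_hSCAT_of_factorisation`, K2E3-p29's axis letters);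
`hCT` ∕ `hfac` ∕ `φt` ⇐ ★ `borelConstantTerm_chiPairEisenstein_cm_three_eq_add_mul` + ★ p864880 `exists_eulerFactorisation_of_tubeClause` ∘ `hunfK^τ` (★ p865032 ∕ p865072, F0P2-p11);
`hsrc hA32` ⇐ ★ p864821 + ★ `hA32_shifted_of_record_at_basePoint_of_modEq`; `hMS` ⇐ ★ p865152; the witness ⇐ K2E1-p13 ∕ K2E1-p11 (shifted pure tensor, `IsArchFinite`).
HONEST LABEL: HC_CM is proved only modulo the 7 printed citations (2 remaining named inputs: hLiu418 = `stmt-HodgeConjecture-24832`, h413 = `stmt-HodgeConjecture-24833`) until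
rung 0 closes; (V-τ) ED. 1 = ★ assembly ∘ ★ τ-exports MODULO {`hPL`, `hCT` + (ii)-rest, (iii), `hMS`} — letters with named payers, not payments; :358 stays `sorry` in B; REL ≠ ★ ≠ WRITTEN ≠
BUILT; count-neutral.

## References
* [Rogawski1990] J. D. Rogawski, *Automorphic Representations of Unitary Groups in Three Variables* (1990), §13.3 p. 202, §13.9 (ii) p. 229.
* [MoeglinWaldspurger1995] C. Mœglin, J.-L. Waldspurger, *Spectral Decomposition and Eisenstein Series* (1995), I.4.11, IV.1.8–IV.1.11, V.3.13.
* [BernsteinLapid2019] J. Bernstein, E. Lapid, *On the meromorphic continuation of Eisenstein series*, J. Amer. Math. Soc. 37 (2024), Thm 2.3, §4.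
* [Conway1978] J. B. Conway, *Functions of One Complex Variable* (2nd ed., 1978), V §1 (Riemann's removable singularity theorem), VI §2 (Schwarz's lemma).
-/

set_option autoImplicit false
set_option linter.dupNamespace false  -- the mandated namespace `…HodgeConjecture.HodgeConjecture.R90.S8` (LEAD #1 L1) repeats the summit's segment

noncomputable section

open MeasureTheory Measure NumberField IsDedekindDomain Set Filter Topology Metric Function
open scoped ENNReal NNReal MatrixGroups
open Literature.MeasureTheory.Group Literature.NumberTheory
open Literature.NumberTheory.Automorphic Literature.NumberTheory.Automorphic.UnitaryGroup Literature.NumberTheory.LFunctions Literature.NumberTheory.GaloisRepresentations AdelicGroupData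
open Literature.NumberTheory.Automorphic.Arthur2013.Leaves.TECR Literature.NumberTheory.Rogawski1990 ContRepresentation
open Summit.HodgeConjecture.HodgeConjecture.Cruxes.H413.K2E1BorelEisensteinU
open Summit.HodgeConjecture.HodgeConjecture.Cruxes.H413.K2E1BLBorelSpacesU2Defs
open Summit.HodgeConjecture.HodgeConjecture.Cruxes.H413.K2E1BLBorelOperatorsU2Defs
open Summit.HodgeConjecture.HodgeConjecture.Cruxes.H413.K2E1CharacterEisensteinU2Defs
open Summit.HodgeConjecture.HodgeConjecture.Cruxes.H413.K2E1ChiSectionSpaceU2Defs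
open Summit.HodgeConjecture.HodgeConjecture.Cruxes.H413.K2E1CharacterEisensteinU3PairDefs
open Summit.HodgeConjecture.HodgeConjecture.Cruxes.H413.K2E1ChiSectionSpaceU3PairDefs
open Summit.HodgeConjecture.HodgeConjecture.Cruxes.H413.K2E1HeckeLHalfNeZeroDefs (LHalfNeZero)
open Summit.HodgeConjecture.HodgeConjecture.Cruxes.H413.K2E1ChiEisensteinPoleLedgerCMThree (continuous_at_removable_of_joint_bound locally_bounded_at_removable_of_joint_bound)

namespace Summit.HodgeConjecture.HodgeConjecture.R90.S8

/-! ## §1 The layer-2 rows (E4) (E2-bd) of the REPAIRED continuation on the slit plane `{1 < Re} ∖ {3∕2}` -/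

section Repaired

variable {X : Type*}

/-- Near any point, on a PUNCTURED neighbourhood, the repaired family agrees with the original (the candidate set `P` is co-discrete). [cite: Conway1978, V §1] -/
theorem repaired_eventuallyEq (E E' : ℂ → X → ℂ) (P : Set ℂ) (hPcd : ∀ z₀ : ℂ, ∀ᶠ s in 𝓝[≠] z₀, s ∉ P)
    (hoff : ∀ z g, ¬ (z ∈ P ∧ 1 < z.re ∧ z ≠ ((3 : ℂ) / 2)) → E' z g = E z g) (z₁ : ℂ) :
    ∀ᶠ z in 𝓝[≠] z₁, ∀ g, E' z g = E z g :=
  (hPcd z₁).mono fun z hz g => hoff z g fun h => hz h.1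

/-- Off `P` (closed), on a FULL neighbourhood, the repaired family agrees with the original. [cite: Conway1978, V §1] -/
theorem repaired_eventuallyEq_nhds (E E' : ℂ → X → ℂ) (P : Set ℂ) (hPc : IsClosed P)
    (hoff : ∀ z g, ¬ (z ∈ P ∧ 1 < z.re ∧ z ≠ ((3 : ℂ) / 2)) → E' z g = E z g) {z₁ : ℂ} (hz₁ : z₁ ∉ P) (g : X) :
    (fun z => E' z g) =ᶠ[𝓝 z₁] fun z => E z g := by
  filter_upwards [hPc.isOpen_compl.mem_nhds hz₁] with w hw
  exact hoff w g fun h => hw h.1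

/-- **At a repaired candidate every `Ec♯ · g` is ANALYTIC** (Riemann: the limit-update of a function holomorphic and bounded on a punctured disc, ★ `analyticAt_update_limUnder_of_eventually_bounded`;
the repaired family IS that update near the point). [cite: Conway1978, V §1] [cite: MoeglinWaldspurger1995, IV.1.11] -/
theorem analyticAt_of_repaired (E E' : ℂ → X → ℂ) (P : Set ℂ) (hPcd : ∀ z₀ : ℂ, ∀ᶠ s in 𝓝[≠] z₀, s ∉ P)
    (hEan : ∀ g (z : ℂ), z ∉ P → AnalyticAt ℂ (fun z => E z g) z)
    (hbdd : ∀ g, ∀ z₀ ∈ P, 1 < z₀.re → z₀ ≠ ((3 : ℂ) / 2) → ∃ C : ℝ, ∀ᶠ z in 𝓝[≠] z₀, ‖E z g‖ ≤ C)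
    (hoff : ∀ z g, ¬ (z ∈ P ∧ 1 < z.re ∧ z ≠ ((3 : ℂ) / 2)) → E' z g = E z g)
    (hon : ∀ z g, z ∈ P → 1 < z.re → z ≠ ((3 : ℂ) / 2) → E' z g = limUnder (𝓝[≠] z) (fun w => E w g))
    {z₁ : ℂ} (hz₁P : z₁ ∈ P) (hz₁ : 1 < z₁.re) (hz₁' : z₁ ≠ ((3 : ℂ) / 2)) (g : X) : AnalyticAt ℂ (fun z => E' z g) z₁ := by
  have hda : ∀ᶠ w in 𝓝[≠] z₁, DifferentiableAt ℂ (fun w => E w g) w := (hPcd z₁).mono fun w hw => (hEan g w hw).differentiableAt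
  have hup := analyticAt_update_limUnder_of_eventually_bounded hda (hbdd g z₁ hz₁P hz₁ hz₁')
  have hev : (fun w => E' w g) =ᶠ[𝓝 z₁] update (fun w => E w g) z₁ (limUnder (𝓝[≠] z₁) fun w => E w g) := by
    have h1 : ∀ᶠ w in 𝓝 z₁, w ≠ z₁ → w ∉ P := eventually_nhdsWithin_iff.1 (hPcd z₁)
    filter_upwards [h1] with w hw
    by_cases hwz : w = z₁
    · subst hwz; rw [update_self]; exact hon _ g hz₁P hz₁ hz₁'
    · rw [update_of_ne hwz]; exact hoff _ g fun h => hw hwz h.1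
  exact hup.congr hev.symm

/-- **(E4) OF THE REPAIRED FAMILY ON THE SLIT PLANE** (`X` weakly locally compact): at a repaired candidate by ★ `continuous_at_removable_of_joint_bound` (Schwarz's lemma) fed with the
analyticity above and the PUNCTURED data of the original family (there the two agree); off `P` the two families agree on a full neighbourhood. [cite: Conway1978, VI §2]
[cite: BernsteinLapid2019, §4 p. 10] [cite: MoeglinWaldspurger1995, IV.1.9–IV.1.11] -/
theorem continuous_slit_of_repaired [TopologicalSpace X] [WeaklyLocallyCompactSpace X] (E E' : ℂ → X → ℂ) (P : Set ℂ) (hPc : IsClosed P) (hPcd : ∀ z₀ : ℂ, ∀ᶠ s in 𝓝[≠] z₀, s ∉ P)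
    (hEan : ∀ g (z : ℂ), z ∉ P → AnalyticAt ℂ (fun z => E z g) z) (hE4 : ∀ z : ℂ, z ∉ P → Continuous (E z))
    (hbddPK : ∀ z₀ ∈ P, 1 < z₀.re → z₀ ≠ ((3 : ℂ) / 2) → ∀ K : Set X, IsCompact K → ∃ C : ℝ, ∀ᶠ z in 𝓝[≠] z₀, ∀ g ∈ K, ‖E z g‖ ≤ C)
    (hoff : ∀ z g, ¬ (z ∈ P ∧ 1 < z.re ∧ z ≠ ((3 : ℂ) / 2)) → E' z g = E z g)
    (hon : ∀ z g, z ∈ P → 1 < z.re → z ≠ ((3 : ℂ) / 2) → E' z g = limUnder (𝓝[≠] z) (fun w => E w g)) :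
    ∀ z ∈ ({z : ℂ | 1 < z.re} \ (↑({(3 : ℂ) / 2} : Finset ℂ) : Set ℂ)), Continuous (E' z) := by
  intro z₁ hz₁
  have h1 : 1 < z₁.re := hz₁.1
  have h32 : z₁ ≠ ((3 : ℂ) / 2) := fun h => hz₁.2 (by rw [h]; simp)
  have hbdd1 : ∀ g, ∀ z₀ ∈ P, 1 < z₀.re → z₀ ≠ ((3 : ℂ) / 2) → ∃ C : ℝ, ∀ᶠ z in 𝓝[≠] z₀, ‖E z g‖ ≤ C := fun g z₀ ha hb hc => by
    obtain ⟨C, hC⟩ := hbddPK z₀ ha hb hc {g} isCompact_singleton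
    exact ⟨C, hC.mono fun z hz => hz g rfl⟩
  by_cases hP : z₁ ∈ P
  · refine continuous_at_removable_of_joint_bound E' (fun g => analyticAt_of_repaired E E' P hPcd hEan hbdd1 hoff hon hP h1 h32 g) ?_ fun K hK => ?_
    · filter_upwards [hPcd z₁, repaired_eventuallyEq E E' P hPcd hoff z₁] with z hzP hz
      refine ⟨fun g => ((hEan g z hzP).differentiableAt).congr_of_eventuallyEq (repaired_eventuallyEq_nhds E E' P hPc hoff hzP g), ?_⟩
      rw [show E' z = E z from funext hz]
      exact hE4 z hzP
    · obtain ⟨C, hC⟩ := hbddPK z₁ hP h1 h32 K hK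
      exact ⟨C, (hC.and (repaired_eventuallyEq E E' P hPcd hoff z₁)).mono fun z hz g hg => by rw [hz.2 g]; exact hz.1 g hg⟩
  · rw [show E' z₁ = E z₁ from funext fun g => hoff z₁ g fun h => hP h.1]
    exact hE4 z₁ hP

/-- **(E2-bd) OF THE REPAIRED FAMILY ON THE SLIT PLANE**: at a repaired candidate by ★ `locally_bounded_at_removable_of_joint_bound` (continuity of each `Ec♯ · g` there + the punctured
joint bound of the original); off `P` the original's neighbourhood is shrunk into `Pᶜ`, where the two agree. [cite: Conway1978, V §1] [cite: MoeglinWaldspurger1995, IV.1.9–IV.1.11] -/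
theorem locallyBounded_slit_of_repaired [TopologicalSpace X] (E E' : ℂ → X → ℂ) (P : Set ℂ) (hPc : IsClosed P) (hPcd : ∀ z₀ : ℂ, ∀ᶠ s in 𝓝[≠] z₀, s ∉ P)
    (hEan : ∀ g (z : ℂ), z ∉ P → AnalyticAt ℂ (fun z => E z g) z)
    (hEbd : ∀ z₁ : ℂ, z₁ ∉ P → ∀ K : Set X, IsCompact K → ∃ V ∈ 𝓝 z₁, ∃ M : ℝ, ∀ z ∈ V, ∀ g ∈ K, ‖E z g‖ ≤ M)
    (hbddPK : ∀ z₀ ∈ P, 1 < z₀.re → z₀ ≠ ((3 : ℂ) / 2) → ∀ K : Set X, IsCompact K → ∃ C : ℝ, ∀ᶠ z in 𝓝[≠] z₀, ∀ g ∈ K, ‖E z g‖ ≤ C)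
    (hoff : ∀ z g, ¬ (z ∈ P ∧ 1 < z.re ∧ z ≠ ((3 : ℂ) / 2)) → E' z g = E z g)
    (hon : ∀ z g, z ∈ P → 1 < z.re → z ≠ ((3 : ℂ) / 2) → E' z g = limUnder (𝓝[≠] z) (fun w => E w g)) :
    ∀ z₁ ∈ ({z : ℂ | 1 < z.re} \ (↑({(3 : ℂ) / 2} : Finset ℂ) : Set ℂ)), ∀ K : Set X, IsCompact K → ∃ V ∈ 𝓝 z₁, ∃ M : ℝ, ∀ z ∈ V, ∀ g ∈ K, ‖E' z g‖ ≤ M := by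
  intro z₁ hz₁ K hK
  have h1 : 1 < z₁.re := hz₁.1
  have h32 : z₁ ≠ ((3 : ℂ) / 2) := fun h => hz₁.2 (by rw [h]; simp)
  have hbdd1 : ∀ g, ∀ z₀ ∈ P, 1 < z₀.re → z₀ ≠ ((3 : ℂ) / 2) → ∃ C : ℝ, ∀ᶠ z in 𝓝[≠] z₀, ‖E z g‖ ≤ C := fun g z₀ ha hb hc => by
    obtain ⟨C, hC⟩ := hbddPK z₀ ha hb hc {g} isCompact_singleton
    exact ⟨C, hC.mono fun z hz => hz g rfl⟩
  by_cases hP : z₁ ∈ P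
  · refine locally_bounded_at_removable_of_joint_bound E' (fun g _ => (analyticAt_of_repaired E E' P hPcd hEan hbdd1 hoff hon hP h1 h32 g).continuousAt) ?_
    obtain ⟨C, hC⟩ := hbddPK z₁ hP h1 h32 K hK
    exact ⟨C, (hC.and (repaired_eventuallyEq E E' P hPcd hoff z₁)).mono fun z hz g hg => by rw [hz.2 g]; exact hz.1 g hg⟩
  · obtain ⟨V, hV, M, hM⟩ := hEbd z₁ hP K hK
    refine ⟨V ∩ Pᶜ, inter_mem hV (hPc.isOpen_compl.mem_nhds hP), M, fun z hz g hg => ?_⟩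
    rw [hoff z g fun h => hz.2 h.1]
    exact hM z hz.1 g hg

end Repaired

/-! ## §2 HEAD A — the rows head: ★ p863385 at a τ-level witness with the exported continuation REPAIRED -/

section Heads

variable (L : Type) [Field L] [NumberField L] [IsCMField L]
  [MeasurableSpace (quasiSplit (↥(maximalRealSubfield L)) L (IsCMField.complexConj L) 3).Adelic] [BorelSpace (quasiSplit (↥(maximalRealSubfield L)) L (IsCMField.complexConj L) 3).Adelic]
  [MeasurableSpace (arch (↥(maximalRealSubfield L)) L (IsCMField.complexConj L) 3 ((StdForm.antidiagonal 3).over L))] [BorelSpace (arch (↥(maximalRealSubfield L)) L (IsCMField.complexConj L) 3 ((StdForm.antidiagonal 3).over L))]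
  [MeasurableSpace (finAdelic (↥(maximalRealSubfield L)) L (IsCMField.complexConj L) 3 ((StdForm.antidiagonal 3).over L))] [BorelSpace (finAdelic (↥(maximalRealSubfield L)) L (IsCMField.complexConj L) 3 ((StdForm.antidiagonal 3).over L))]

omit [MeasurableSpace (arch (↥(maximalRealSubfield L)) L (IsCMField.complexConj L) 3 ((StdForm.antidiagonal 3).over L))] [BorelSpace (arch (↥(maximalRealSubfield L)) L (IsCMField.complexConj L) 3 ((StdForm.antidiagonal 3).over L))]
  [MeasurableSpace (finAdelic (↥(maximalRealSubfield L)) L (IsCMField.complexConj L) 3 ((StdForm.antidiagonal 3).over L))] [BorelSpace (finAdelic (↥(maximalRealSubfield L)) L (IsCMField.complexConj L) 3 ((StdForm.antidiagonal 3).over L))] in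
/-- **HEAD A — `resGMidBlock_ne_bot_of_tauGenerator_rows`: `LHalfNeZero (ξ.bcη⁻¹·μω) → resGMidBlock L μ ξ μω ≠ ⊥` FROM A τ-LEVEL WITNESS, ITS EXPORTED CONTINUATION (★ p865131's NF-free
shape, as binders) AND THE POLE LEDGER**, rows (ii) (iii) (i′) of ★ p863385 VERBATIM (with `D ⊆ Pᶜ`).  The continuation is repaired at the removable candidates of `{1 < Re} ∖ {3∕2}` (★
`differentiableOn_slit_of_repaired`, `exists_poleLetter_of_repaired`, `repaired_eq_of_two_lt_re`), its layer-2 rows are §1, rows (ii) (i′) are transported along `Ec♯ = Ec` on `D ⊆ Pᶜ`, and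
★ p863385 is called at `(K′ := ι_f U₀, ω := 1, φ, Ec♯, Sp := {3∕2})`. [cite: Rogawski1990, §13.9 (ii) p. 229] [cite: MoeglinWaldspurger1995, IV.1.11, I.4.11] [cite: Conway1978, V §1] -/
theorem resGMidBlock_ne_bot_of_tauGenerator_rows
    (μ : Measure (quasiSplit (↥(maximalRealSubfield L)) L (IsCMField.complexConj L) 3).automorphicQuotient) [(quasiSplit (↥(maximalRealSubfield L)) L (IsCMField.complexConj L) 3).IsAutomorphicMeasure μ]
    (μω : HeckeCharacter L) (hμu : μω.IsUnitary)
    (hμω : ∀ x : ideleGroup ↥(maximalRealSubfield L), μω (AdeleRing.ideleBaseChange (↥(maximalRealSubfield L)) L x) = quadraticHeckeCharCM L x)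
    (ξ : OneDimAutRepH L)
    -- (i) THE τ-ADMISSIBLE WITNESS at the finite-only level `(K′ := ι_f U₀, ω := 1)` (★ D1 ∕ T1 conventions; no `K_∞`-equivariance imposed)
    (U₀ : Subgroup ↥(finAdelic (↥(maximalRealSubfield L)) L (IsCMField.complexConj L) 3 ((StdForm.antidiagonal 3).over L)))
    (φ : (quasiSplit (↥(maximalRealSubfield L)) L (IsCMField.complexConj L) 3).Adelic → ℂ) (hφ : φ ∈ chiSectionSpacePair (ξ.bcη⁻¹ * ξ.bcψ⁻¹ * μω) ξ.ψ (tauLevel L U₀) ((1 : ↥(tauLevel L U₀) →* ℂ) : ↥(tauLevel L U₀) → ℂ)) (hφc : Continuous φ)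
    -- (i) THE EXPORTED CONTINUATION in ★ p865131's NF-free shape (payer: ★ `hTEXP6_row_of_ports … hμu (hCO_of_transposeRealisations … hμu)` — see `resGMidBlock_ne_bot_of_tauGenerator_letters`)
    (Ec : ℂ → (quasiSplit (↥(maximalRealSubfield L)) L (IsCMField.complexConj L) 3).Adelic → ℂ) (P : Set ℂ) (hPc : IsClosed P) (hPcd : ∀ z₀ : ℂ, ∀ᶠ s in 𝓝[≠] z₀, s ∉ P) (hPre : ∀ z ∈ P, z.re ≤ 2)
    (hEcE : ∀ z : ℂ, 2 < z.re → Ec z = eisensteinSeriesU (flatSectionU φ z)) (hEan : ∀ g (z : ℂ), z ∉ P → AnalyticAt ℂ (fun z => Ec z g) z)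
    (hE4 : ∀ z : ℂ, z ∉ P → Continuous (Ec z))
    (hEbd : ∀ z₁ : ℂ, z₁ ∉ P → ∀ K : Set (quasiSplit (↥(maximalRealSubfield L)) L (IsCMField.complexConj L) 3).Adelic, IsCompact K → ∃ V ∈ 𝓝 z₁, ∃ M : ℝ, ∀ z ∈ V, ∀ g ∈ K, ‖Ec z g‖ ≤ M)
    -- (i) THE POLE LEDGER (estate T's `hPL` bytes, ★ p863972's (B-P-K) ∕ (B-3∕2)): joint removability at the candidates of `{1 < Re} ∖ {3∕2}`, a simple pole at `3∕2`
    (hbddPK : ∀ z₀ ∈ P, 1 < z₀.re → z₀ ≠ ((3 : ℂ) / 2) → ∀ K : Set (quasiSplit (↥(maximalRealSubfield L)) L (IsCMField.complexConj L) 3).Adelic, IsCompact K → ∃ C : ℝ, ∀ᶠ z in 𝓝[≠] z₀, ∀ g ∈ K, ‖Ec z g‖ ≤ C)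
    (hbdd32 : ∀ g, ∃ C : ℝ, ∀ᶠ z in 𝓝[≠] ((3 : ℂ) / 2), ‖(z - ((3 : ℂ) / 2)) * Ec z g‖ ≤ C)
    -- (ii) ★ p863385's row (ii) VERBATIM, on a domain `D` AVOIDING the candidate set `P` (payers: ★ `borelConstantTerm_chiPairEisenstein_cm_three_eq_add_mul` on the tube + ★ p864880's Euler factorisation of `hunfK^τ` ★ p865072)
    (ν : Measure ↥(adelicUnipotent (↥(maximalRealSubfield L)) L (IsCMField.complexConj L) 3)) [ν.IsHaarMeasure]
    {𝓕 : Set ↥(adelicUnipotent (↥(maximalRealSubfield L)) L (IsCMField.complexConj L) 3)}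
    (h𝓕N : IsFundamentalDomain ↥(rationalUnipotent (↥(maximalRealSubfield L)) L (IsCMField.complexConj L) 3) 𝓕 ν) (h𝓕c : IsCompact (closure 𝓕))
    {D : Set ℂ} (hDo : IsOpen D) (hD : ∀ᶠ z in 𝓝[≠] ((3 : ℂ) / 2), z ∈ D) (hDsub : D ⊆ ({z : ℂ | 1 < z.re} \ (↑({(3 : ℂ) / 2} : Finset ℂ) : Set ℂ))) (hDP : D ⊆ Pᶜ)
    (ψ φt : ℂ → (quasiSplit (↥(maximalRealSubfield L)) L (IsCMField.complexConj L) 3).Adelic → ℂ)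
    (hE3 : ∀ z ∈ D, ∀ g : (quasiSplit (↥(maximalRealSubfield L)) L (IsCMField.complexConj L) 3).Adelic, borelConstantTerm ν 𝓕 (Ec z) g = φ g * (((borelHeight g : ℝ≥0) : ℝ) : ℂ) ^ z + ψ z g * (((borelHeight g : ℝ≥0) : ℝ) : ℂ) ^ (2 - z))
    (q qc : ℂ → ℂ) {Pq : Set ℂ} (hqcq : ∀ z : ℂ, 2 < z.re → qc z = q z) (hPqcd : ∀ z₀ : ℂ, ∀ᶠ s in 𝓝[≠] z₀, s ∉ Pq) (hqa : ∀ z : ℂ, z ∉ Pq → AnalyticAt ℂ qc z)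
    (hfac : ∀ᶠ z in 𝓝[≠] ((3 : ℂ) / 2), ∀ g, ψ z g = qc z * φt z g) (hφt : ∀ g, ContinuousAt (fun z => φt z g) ((3 : ℂ) / 2))
    {g₀ : (quasiSplit (↥(maximalRealSubfield L)) L (IsCMField.complexConj L) 3).Adelic} (hg₀ : φt ((3 : ℂ) / 2) g₀ ≠ 0) {Cφt : ℝ} (hφtbd : ∀ g, ‖φt ((3 : ℂ) / 2) g‖ ≤ Cφt)
    -- (iii) ★ p863385's row (iii) VERBATIM (payers: ★ p864821 + ★ `hA32_shifted_of_record_at_basePoint_of_modEq` for the shifted pure tensor)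
    {S : Set (HeightOneSpectrum (𝓞 L))} {T' : Set (HeightOneSpectrum (𝓞 ↥(maximalRealSubfield L)))}
    (hS : S.Finite) (hurφ : ∀ w ∉ S, (ξ.bcη⁻¹ * μω).IsUnramifiedAt w) (hT' : T'.Finite) (hurη : ∀ v ∉ T', (1 : HeckeCharacter ↥(maximalRealSubfield L)).IsUnramifiedAt v)
    (A : ℂ → ℂ) (hA : DifferentiableOn ℂ A {z : ℂ | 1 < z.re})
    (hsrc : ∀ z : ℂ, 2 < z.re → q z = A z *
          ((partialStandardL S (fun w => {(ξ.bcη⁻¹ * μω).valueAtUniformizer w}) (z - 1) * partialStandardL T' (fun v => {(1 : HeckeCharacter ↥(maximalRealSubfield L)).valueAtUniformizer v}) (2 * z - 2)) /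
            (partialStandardL S (fun w => {(ξ.bcη⁻¹ * μω).valueAtUniformizer w}) z * partialStandardL T' (fun v => {(1 : HeckeCharacter ↥(maximalRealSubfield L)).valueAtUniformizer v}) (2 * z - 1))))
    (hA32 : A (3 / 2) ≠ 0)
    -- (i′) the (E6) truncated family of the export on `D` (payer: ★ p865131's (E6) clause) and the Maass–Selberg letter at the middle pole (payer: ★ p865152)
    {T : ℝ≥0} (hT : 1 ≤ T) (Fam : ℂ → (quasiSplit (↥(maximalRealSubfield L)) L (IsCMField.complexConj L) 3).L2 μ) (hFd : DifferentiableOn ℂ Fam D)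
    (hFam : ∀ z ∈ D, ((Fam z : (quasiSplit (↥(maximalRealSubfield L)) L (IsCMField.complexConj L) 3).L2 μ) : (quasiSplit (↥(maximalRealSubfield L)) L (IsCMField.complexConj L) 3).automorphicQuotient → ℂ) =ᵐ[μ] (quasiSplit (↥(maximalRealSubfield L)) L (IsCMField.complexConj L) 3).quotFun (truncation ν 𝓕 T (Ec z)))
    (hMS : ∃ C : ℝ, ∀ᶠ z in 𝓝[≠] ((3 : ℂ) / 2), ‖(z - ((3 : ℂ) / 2)) • Fam z‖ ≤ C) :
    LHalfNeZero (ξ.bcη⁻¹ * μω) → resGMidBlock L μ ξ μω ≠ ⊥ := by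
  classical
  intro hL
  haveI : LocallyCompactSpace (quasiSplit (↥(maximalRealSubfield L)) L (IsCMField.complexConj L) 3).Adelic :=
    inferInstanceAs (LocallyCompactSpace (adelic (↥(maximalRealSubfield L)) L (IsCMField.complexConj L) 3 ((StdForm.antidiagonal 3).over L)))
  -- the repaired continuation
  obtain ⟨E', hoff, hon⟩ : ∃ E' : ℂ → (quasiSplit (↥(maximalRealSubfield L)) L (IsCMField.complexConj L) 3).Adelic → ℂ,
      (∀ z g, ¬ (z ∈ P ∧ 1 < z.re ∧ z ≠ ((3 : ℂ) / 2)) → E' z g = Ec z g) ∧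
      (∀ z g, z ∈ P → 1 < z.re → z ≠ ((3 : ℂ) / 2) → E' z g = limUnder (𝓝[≠] z) (fun w => Ec w g)) :=
    ⟨fun z g => if z ∈ P ∧ 1 < z.re ∧ z ≠ ((3 : ℂ) / 2) then limUnder (𝓝[≠] z) (fun w => Ec w g) else Ec z g,
      fun z g h => if_neg h, fun z g h1 h2 h3 => if_pos ⟨h1, h2, h3⟩⟩
  have hbddP : ∀ g, ∀ z₀ ∈ P, 1 < z₀.re → z₀ ≠ ((3 : ℂ) / 2) → ∃ C : ℝ, ∀ᶠ z in 𝓝[≠] z₀, ‖Ec z g‖ ≤ C := fun g z₀ hz₀P hz₀ hz₀' => by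
    obtain ⟨C, hC⟩ := hbddPK z₀ hz₀P hz₀ hz₀' {g} isCompact_singleton
    exact ⟨C, hC.mono fun z hz => hz g rfl⟩
  -- row (i) of ★ p863385 for the repaired family, `Sp := {3∕2}`
  have hSp : ∀ s ∈ (({((3 : ℂ) / 2)} : Finset ℂ)), s.im = 0 ∧ 1 < s.re ∧ s.re ≤ 2 := fun s hs => by
    rw [Finset.mem_singleton] at hs
    subst hs
    exact ⟨by norm_num, by norm_num, by norm_num⟩
  have hEd := differentiableOn_slit_of_repaired Ec E' P hPc hPcd hEan hbddP hoff hon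
  have hE2' : ∀ z : ℂ, 2 < z.re → E' z = eisensteinSeriesU (flatSectionU φ z) := repaired_eq_of_two_lt_re Ec E' P hPre hoff hEcE
  obtain ⟨Fp, hF, hFE⟩ := exists_poleLetter_of_repaired Ec E' P hPcd hEan hbdd32 hoff
  have hE4' := continuous_slit_of_repaired Ec E' P hPc hPcd hEan hE4 hbddPK hoff hon
  have hEbd' := locallyBounded_slit_of_repaired Ec E' P hPc hPcd hEan hEbd hbddPK hoff hon
  -- rows (ii) (i′) transported along `Ec♯ = Ec` on `D ⊆ Pᶜ`
  have hED : ∀ z ∈ D, E' z = Ec z := fun z hz => funext fun g => hoff z g fun h => hDP hz h.1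
  have hE3' : ∀ z ∈ D, ∀ g : (quasiSplit (↥(maximalRealSubfield L)) L (IsCMField.complexConj L) 3).Adelic, borelConstantTerm ν 𝓕 (E' z) g = φ g * (((borelHeight g : ℝ≥0) : ℝ) : ℂ) ^ z + ψ z g * (((borelHeight g : ℝ≥0) : ℝ) : ℂ) ^ (2 - z) := fun z hz g => by
    rw [hED z hz]
    exact hE3 z hz g
  have hFam' : ∀ z ∈ D, ((Fam z : (quasiSplit (↥(maximalRealSubfield L)) L (IsCMField.complexConj L) 3).L2 μ) : (quasiSplit (↥(maximalRealSubfield L)) L (IsCMField.complexConj L) 3).automorphicQuotient → ℂ) =ᵐ[μ] (quasiSplit (↥(maximalRealSubfield L)) L (IsCMField.complexConj L) 3).quotFun (truncation ν 𝓕 T (E' z)) := fun z hz => by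
    rw [hED z hz]
    exact hFam z hz
  exact resGMidBlock_ne_bot_assembly L μ μω hμu hμω ξ (tauLevel L U₀) 1 φ hφ hφc E' _ hSp hEd hE2' Fp hF hFE hE4' hEbd' ν h𝓕N h𝓕c hDo hD hDsub ψ φt hE3' q qc hqcq hPqcd hqa
    hfac hφt hg₀ hφtbd hS hurφ hT' hurη A hA hsrc hA32 hT Fam hFd hFam' hMS hL

/-! ## §3 HEAD B — the (V-τ) letter head: the exports BOUND (★ p865131 ∘ ★ p864934), the continuation rows as letters over the export candidates -/

/-- **HEAD B — `resGMidBlock_ne_bot_of_tauGenerator_letters` ((V-τ), ED. 1): `LHalfNeZero (ξ.bcη⁻¹·μω) → resGMidBlock L μ ξ μω ≠ ⊥` FROM A τ-ADMISSIBLE WITNESS `(U₀, φ)` —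
`K_∞`-finite, continuous, of level `(ι_f U₀, 1)` — and a normalised Heisenberg package**, over the (V) frame and the exports' frame (F)(F′): the K-finite exports WITH the truncated
family are ★ `hTEXP6_row_of_ports … hμu (hCO_of_transposeRealisations … hμu)` at the witness; the continuation rows are the letters `hPL` (pole ledger, estate T's clause shape), `hCT`
(constant term off the candidate set, on `D`) and `hMS` (Maass–Selberg at `3∕2`, `T := 1`), quantified over the export candidates; rows (ii)-rest and (iii) are ★ p863385's binders.  PROOF:
obtain the export, take its (E6) family at `T := 1`, intersect `D` with `Pᶜ` (both punctured neighbourhoods of `3∕2`, `P` closed), and call HEAD A.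
[cite: Rogawski1990, §13.9 (ii) p. 229] [cite: MoeglinWaldspurger1995, IV.1.11, V.3.13, I.4.11] [cite: BernsteinLapid2019, Thm 2.3, §4] -/
theorem resGMidBlock_ne_bot_of_tauGenerator_letters
    (μ : Measure (quasiSplit (↥(maximalRealSubfield L)) L (IsCMField.complexConj L) 3).automorphicQuotient) [(quasiSplit (↥(maximalRealSubfield L)) L (IsCMField.complexConj L) 3).IsAutomorphicMeasure μ]
    (μω : HeckeCharacter L) (hμu : μω.IsUnitary)
    (hμω : ∀ x : ideleGroup ↥(maximalRealSubfield L), μω (AdeleRing.ideleBaseChange (↥(maximalRealSubfield L)) L x) = quadraticHeckeCharCM L x)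
    (ξ : OneDimAutRepH L)
    -- the exports' frame (F)(F′) of ★ p865131 (Haar measure on `G(𝔸)`, covering weight, quotient measure, the ports' auxiliary Haar measures)
    (νG : Measure (quasiSplit (↥(maximalRealSubfield L)) L (IsCMField.complexConj L) 3).Adelic) [νG.IsHaarMeasure] [νG.IsInvInvariant] [SFinite νG]
    {β : (quasiSplit (↥(maximalRealSubfield L)) L (IsCMField.complexConj L) 3).Adelic → ℝ≥0∞}
    (hβ : IsCoveringWeight ↥((arithmeticBorel (↥(maximalRealSubfield L)) L (IsCMField.complexConj L) 3).map (quasiSplit (↥(maximalRealSubfield L)) L (IsCMField.complexConj L) 3).arithmeticSubgroup.subtype) β)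
    {μZ : Measure (borelQuotient (↥(maximalRealSubfield L)) L (IsCMField.complexConj L) 3)} [SFinite μZ]
    (hμZ : ∀ f : borelQuotient (↥(maximalRealSubfield L)) L (IsCMField.complexConj L) 3 → ℝ≥0∞, Measurable f → ∫⁻ z, f z ∂μZ = ∫⁻ g, β g * f (toBorelQuotient (↥(maximalRealSubfield L)) L (IsCMField.complexConj L) 3 g) ∂νG)
    (μa : Measure (arch (↥(maximalRealSubfield L)) L (IsCMField.complexConj L) 3 ((StdForm.antidiagonal 3).over L))) [μa.IsHaarMeasure] [μa.IsMulRightInvariant]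
    (μf : Measure (finAdelic (↥(maximalRealSubfield L)) L (IsCMField.complexConj L) 3 ((StdForm.antidiagonal 3).over L))) [μf.IsHaarMeasure]
    -- (i) THE τ-ADMISSIBLE WITNESS AS DATA: a τ-level `U₀`, a continuous `K_∞`-finite pair-section of level `(ι_f U₀, 1)` (e.g. the shifted pure tensor `Φ^{p,q}_∞ ⊗ Φ_f`)
    (U₀ : Subgroup ↥(finAdelic (↥(maximalRealSubfield L)) L (IsCMField.complexConj L) 3 ((StdForm.antidiagonal 3).over L))) (hU₀ : IsTauLevel L U₀)
    (φ : (quasiSplit (↥(maximalRealSubfield L)) L (IsCMField.complexConj L) 3).Adelic → ℂ) (hφ : φ ∈ chiSectionSpacePair (ξ.bcη⁻¹ * ξ.bcψ⁻¹ * μω) ξ.ψ (tauLevel L U₀) ((1 : ↥(tauLevel L U₀) →* ℂ) : ↥(tauLevel L U₀) → ℂ)) (hφc : Continuous φ) (hφa : IsArchFinite L φ)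
    -- the NORMALISED Heisenberg package of ★ p865131's row (Haar, inversion-invariant, `ν 𝓕 = 1`)
    (ν : Measure ↥(adelicUnipotent (↥(maximalRealSubfield L)) L (IsCMField.complexConj L) 3)) [ν.IsHaarMeasure] [ν.IsInvInvariant]
    {𝓕 : Set ↥(adelicUnipotent (↥(maximalRealSubfield L)) L (IsCMField.complexConj L) 3)}
    (h𝓕N : IsFundamentalDomain ↥(rationalUnipotent (↥(maximalRealSubfield L)) L (IsCMField.complexConj L) 3) 𝓕 ν) (h𝓕c : IsCompact (closure 𝓕)) (h𝓕1 : ν 𝓕 = 1)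
    -- (i) LETTER — THE POLE LEDGER over the exported continuation (estate T's `hPL` clause shape; payers: τ-MS32 ★ p865152, the off-axis machinery of (R)′τ V3)
    (hPL : ∀ (Ec : ℂ → (quasiSplit (↥(maximalRealSubfield L)) L (IsCMField.complexConj L) 3).Adelic → ℂ) (P : Set ℂ), (∀ z : ℂ, 2 < z.re → Ec z = eisensteinSeriesU (flatSectionU φ z)) →
      (∀ z₀ : ℂ, ∀ᶠ s in 𝓝[≠] z₀, s ∉ P) → (∀ g (z : ℂ), z ∉ P → AnalyticAt ℂ (fun z => Ec z g) z) →
      (∀ z₀ ∈ P, 1 < z₀.re → z₀ ≠ ((3 : ℂ) / 2) → ∀ K : Set (quasiSplit (↥(maximalRealSubfield L)) L (IsCMField.complexConj L) 3).Adelic, IsCompact K → ∃ C : ℝ, ∀ᶠ z in 𝓝[≠] z₀, ∀ g ∈ K, ‖Ec z g‖ ≤ C) ∧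
      (∀ g, ∃ C : ℝ, ∀ᶠ z in 𝓝[≠] ((3 : ℂ) / 2), ‖(z - ((3 : ℂ) / 2)) * Ec z g‖ ≤ C))
    -- (ii) ★ p863385's row (ii): the domain `D` and the scalar road's letters; the constant-term identity as a LETTER over the exported continuation OFF its candidate set (payers as in the rows head)
    {D : Set ℂ} (hDo : IsOpen D) (hD : ∀ᶠ z in 𝓝[≠] ((3 : ℂ) / 2), z ∈ D) (hDsub : D ⊆ ({z : ℂ | 1 < z.re} \ (↑({(3 : ℂ) / 2} : Finset ℂ) : Set ℂ)))
    (ψ φt : ℂ → (quasiSplit (↥(maximalRealSubfield L)) L (IsCMField.complexConj L) 3).Adelic → ℂ)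
    (hCT : ∀ (Ec : ℂ → (quasiSplit (↥(maximalRealSubfield L)) L (IsCMField.complexConj L) 3).Adelic → ℂ) (P : Set ℂ), (∀ z : ℂ, 2 < z.re → Ec z = eisensteinSeriesU (flatSectionU φ z)) →
      (∀ z₀ : ℂ, ∀ᶠ s in 𝓝[≠] z₀, s ∉ P) → (∀ g (z : ℂ), z ∉ P → AnalyticAt ℂ (fun z => Ec z g) z) →
      ∀ z ∈ D, z ∉ P → ∀ g : (quasiSplit (↥(maximalRealSubfield L)) L (IsCMField.complexConj L) 3).Adelic, borelConstantTerm ν 𝓕 (Ec z) g = φ g * (((borelHeight g : ℝ≥0) : ℝ) : ℂ) ^ z + ψ z g * (((borelHeight g : ℝ≥0) : ℝ) : ℂ) ^ (2 - z))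
    (q qc : ℂ → ℂ) {Pq : Set ℂ} (hqcq : ∀ z : ℂ, 2 < z.re → qc z = q z) (hPqcd : ∀ z₀ : ℂ, ∀ᶠ s in 𝓝[≠] z₀, s ∉ Pq) (hqa : ∀ z : ℂ, z ∉ Pq → AnalyticAt ℂ qc z)
    (hfac : ∀ᶠ z in 𝓝[≠] ((3 : ℂ) / 2), ∀ g, ψ z g = qc z * φt z g) (hφt : ∀ g, ContinuousAt (fun z => φt z g) ((3 : ℂ) / 2))
    {g₀ : (quasiSplit (↥(maximalRealSubfield L)) L (IsCMField.complexConj L) 3).Adelic} (hg₀ : φt ((3 : ℂ) / 2) g₀ ≠ 0) {Cφt : ℝ} (hφtbd : ∀ g, ‖φt ((3 : ℂ) / 2) g‖ ≤ Cφt)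
    -- (iii) ★ p863385's row (iii) VERBATIM (payers: ★ p864821 + ★ `hA32_shifted_of_record_at_basePoint_of_modEq` for the shifted pure tensor)
    {S : Set (HeightOneSpectrum (𝓞 L))} {T' : Set (HeightOneSpectrum (𝓞 ↥(maximalRealSubfield L)))}
    (hS : S.Finite) (hurφ : ∀ w ∉ S, (ξ.bcη⁻¹ * μω).IsUnramifiedAt w) (hT' : T'.Finite) (hurη : ∀ v ∉ T', (1 : HeckeCharacter ↥(maximalRealSubfield L)).IsUnramifiedAt v)
    (A : ℂ → ℂ) (hA : DifferentiableOn ℂ A {z : ℂ | 1 < z.re})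
    (hsrc : ∀ z : ℂ, 2 < z.re → q z = A z *
          ((partialStandardL S (fun w => {(ξ.bcη⁻¹ * μω).valueAtUniformizer w}) (z - 1) * partialStandardL T' (fun v => {(1 : HeckeCharacter ↥(maximalRealSubfield L)).valueAtUniformizer v}) (2 * z - 2)) /
            (partialStandardL S (fun w => {(ξ.bcη⁻¹ * μω).valueAtUniformizer w}) z * partialStandardL T' (fun v => {(1 : HeckeCharacter ↥(maximalRealSubfield L)).valueAtUniformizer v}) (2 * z - 1))))
    (hA32 : A (3 / 2) ≠ 0)
    -- (i′) LETTER — the Maass–Selberg bound at the middle pole for the exported truncated family (`T := 1`; payer: ★ p865152 `hMS32_midWitness_of_coordLetters (hqa32) (hreal)`)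
    (hMS : ∀ (Ec : ℂ → (quasiSplit (↥(maximalRealSubfield L)) L (IsCMField.complexConj L) 3).Adelic → ℂ) (P : Set ℂ) (Fam : ℂ → (quasiSplit (↥(maximalRealSubfield L)) L (IsCMField.complexConj L) 3).L2 μ), (∀ z : ℂ, 2 < z.re → Ec z = eisensteinSeriesU (flatSectionU φ z)) →
      (∀ z₀ : ℂ, ∀ᶠ s in 𝓝[≠] z₀, s ∉ P) → (∀ g (z : ℂ), z ∉ P → AnalyticAt ℂ (fun z => Ec z g) z) →
      DifferentiableOn ℂ Fam Pᶜ → (∀ z : ℂ, z ∉ P → ((Fam z : (quasiSplit (↥(maximalRealSubfield L)) L (IsCMField.complexConj L) 3).L2 μ) : (quasiSplit (↥(maximalRealSubfield L)) L (IsCMField.complexConj L) 3).automorphicQuotient → ℂ) =ᵐ[μ] (quasiSplit (↥(maximalRealSubfield L)) L (IsCMField.complexConj L) 3).quotFun (truncation ν 𝓕 1 (Ec z))) →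
      ∃ C : ℝ, ∀ᶠ z in 𝓝[≠] ((3 : ℂ) / 2), ‖(z - ((3 : ℂ) / 2)) • Fam z‖ ≤ C) :
    LHalfNeZero (ξ.bcη⁻¹ * μω) → resGMidBlock L μ ξ μω ≠ ⊥ := by
  intro hL
  -- ★ p865131 ∘ ★ p864934: the K-finite exports with the truncated family at the witness and the package
  obtain ⟨Ec, P, hPc, hPcd, hPre, hEcE, hEan, hE4, hEbd, hE6⟩ :=
    hTEXP6_row_of_ports L μ νG hβ hμZ μa μf ξ μω hμu (hCO_of_transposeRealisations L ξ μω hμu) U₀ hU₀ φ hφ hφc hφa ν inferInstance 𝓕 h𝓕N h𝓕c inferInstance h𝓕1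
  obtain ⟨Fam, hFd, hFam⟩ := hE6 1 le_rfl
  obtain ⟨hbddPK, hbdd32⟩ := hPL Ec P hEcE hPcd hEan
  -- the domain `D ∩ Pᶜ`
  have hDo' : IsOpen (D ∩ Pᶜ) := hDo.inter hPc.isOpen_compl
  have hD' : ∀ᶠ z in 𝓝[≠] ((3 : ℂ) / 2), z ∈ D ∩ Pᶜ := (hD.and (hPcd _)).mono fun z hz => ⟨hz.1, hz.2⟩
  exact resGMidBlock_ne_bot_of_tauGenerator_rows L μ μω hμu hμω ξ U₀ φ hφ hφc Ec P hPc hPcd hPre hEcE hEan hE4 hEbd hbddPK hbdd32 ν h𝓕N h𝓕c hDo' hD'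
    (inter_subset_left.trans hDsub) inter_subset_right ψ φt (fun z hz g => hCT Ec P hEcE hPcd hEan z hz.1 hz.2 g) q qc hqcq hPqcd hqa hfac hφt hg₀ hφtbd hS hurφ hT' hurη
    A hA hsrc hA32 le_rfl Fam (hFd.mono inter_subset_right) (fun z hz => hFam z hz.2) (hMS Ec P Fam hEcE hPcd hEan hFd hFam) hL

end Heads

end Summit.HodgeConjecture.HodgeConjecture.R90.S8

end
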